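import Literature.Geometry.Kaehler.ComplexTorusHodgeGroupProductGoursat
import HarnessLib

/-!
# The derived series of `Hg(X₁ × X₂)(ℂ)` versus the factors: `Dⁿ(Hg(X₁ × X₂)(ℂ)) ≤ Dⁿ(Hg(X₁)(ℂ)) × Dⁿ(Hg(X₂)(ℂ))` with
# SURJECTIVE projections (Moonen–Zarhin (3.1) for the derived groups); `Hg(X₁ × X₂)(ℂ)` perfect ⟹ both factors perfect;
# `Hg(X₁ × X₂)(ℂ)` solvable ⟺ `Hg(X₁)(ℂ)` and `Hg(X₂)(ℂ)` solvable — every pair of complex tori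

Layer `Literature/Geometry/Kaehler`, namespace `Literature.Geometry.Kaehler.ComplexTorus`; lane `lit-hodgefound`
(Track 2 foundations library), Layer A3/A4; prover seat `lit-hodgefound-p17` (generation 37, self-proposed row g37-#6,
sequel of g37-#1 `ComplexTorusHodgeGroupProductProjectionsSurjective` and g37-#5 `ComplexTorusHodgeGroupProductGoursat`).
THEOREMS ONLY (no definition, no instance, no notation, no named fact; D-0026 net debt 0). The derived series of a
subgroup `H ≤ SL(V)(ℂ)` is written `(derivedSeries ↥H n).map H.subtype` (Mathlib's `derivedSeries` of the group `↥H`,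
pushed into `SL(V)(ℂ)`), as in g37-#5; solvability is Mathlib's `IsSolvable ↥H` (p22's
`ComplexTorusHodgeGroupSolvableIffCM`: for an abelian variety, `Hg(X)(ℂ)` solvable ⟺ `X` of CM-type).

## Sources, verbatim

* B. Moonen, Yu. G. Zarhin [MoonenZarhin1999LowDim], held `paper:arxiv-math_9901113`, §3 (3.1) (p0006 L25–L28):
  "`Hg(X₁ × X₂)` is an algebraic subgroup of `Hg(X₁) × Hg(X₂)`; the two projections are surjective";
  §1: "If `X` has no factors of Type IV then `Hg(X)` is semi-simple" and "`X` is of CM-type […] iff `Hg(X)` is a torus".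
* B. B. Gordon [Gordon1997], held `paper:arxiv-alg-geom_9709030`, §2.16 Proposition (Goursat's Lemma), first bullet
  (p0012 L112–L119); §2.5.2 Corollary ("`Hg(A)` semisimple"); §2.12 Proposition ("of CM-type if and only if `Hg(A)`
  is an algebraic torus"); §3 Theorem, proof (p0014 L33–L37).
* H. Imai [Imai1976HodgeGroups], §1 (p. 367: "`Hg(A₁ × A₂) ⊂ Hg(A₁) × Hg(A₂)`"), §2 Proposition (p. 370: "Write
  `H = H′·D` […] `q(H′) = q([H, H]) = [q(H), q(H)]`" — the projection of the derived group is the derived group of the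
  projection).

## What is proved (every pair of complex tori `X₁`, `X₂`)

* §1 INCLUSION: **`map_derivedSeries_hodgeGroupC_prod_le_blockDiagProd`** —
  `Dⁿ(Hg(X₁ × X₂)(ℂ)) ≤ Dⁿ(Hg(X₁)(ℂ)) × Dⁿ(Hg(X₂)(ℂ))` (block-diagonally), for every `n`; the blocks of an element of
  `Dⁿ(Hg(X₁ × X₂)(ℂ))` lie in `Dⁿ(Hg(Xᵢ)(ℂ))` (`fst/snd_mem_map_derivedSeries_of_blockDiagC_mem`).
* §2 SURJECTIVE PROJECTIONS (Imai's "`q([H, H]) = [q(H), q(H)]`", all `n`):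
  **`exists_blockDiagC_mem_map_derivedSeries_prod_left/right`** — every `s ∈ Dⁿ(Hg(X₁)(ℂ))` is the first block of
  some `(s 0; 0 t) ∈ Dⁿ(Hg(X₁ × X₂)(ℂ))` with `t ∈ Dⁿ(Hg(X₂)(ℂ))` (and symmetrically);
  `mem_map_derivedSeries_iff_exists_blockDiagC_mem_left/right`.
* §3 TRANSFERS: **`commutator_hodgeGroupC_eq_self_of_prod`** (`Hg(X₁ × X₂)(ℂ)` perfect ⟹ `Hg(X₁)(ℂ)` and
  `Hg(X₂)(ℂ)` perfect), `map_derivedSeries_hodgeGroupC_prod_eq_bot_iff` (`Dⁿ(Hg(X₁ × X₂)) = 1 ⟺ Dⁿ(Hg(X₁)) = 1 ∧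
  Dⁿ(Hg(X₂)) = 1`), **`commutator_hodgeGroupC_prod_eq_bot_iff`** (`(Hg, Hg) = 1` for the product iff for both
  factors — the commutator-subgroup form of p22's `hodgeGroupC_prod_comm_iff`), **`isSolvable_hodgeGroupC_prod_iff`**
  (`Hg(X₁ × X₂)(ℂ)` solvable ⟺ both `Hg(Xᵢ)(ℂ)` solvable), and for polarised tori the radical form
  `IsRiemannForm.radical_map_toGL_hodgeGroupC_eq_bot_of_prod` (`Hg(X₁ × X₂)` semisimple ⟹ `Hg(Xᵢ)` semisimple).

NOT here: the converse "both `Hg(Xᵢ)` semisimple ⟹ `Hg(X₁ × X₂)` semisimple" (needs the radical of `Hg(X₁ × X₂)(ℂ)`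
to be connected and the centres of the `Hg(Xᵢ)` finite — a separate row).

## References

* [MoonenZarhin1999LowDim] B. Moonen, Yu. G. Zarhin, Math. Ann. 315 (1999), §3 (3.1), §1.
* [Gordon1997] B. B. Gordon, *A survey of the Hodge conjecture for abelian varieties* (alg-geom/9709030), §2.16, §2.5.2, §2.12, §3.
* [Imai1976HodgeGroups] H. Imai, *On the Hodge groups of some abelian varieties*, Kodai Math. Sem. Rep. 27 (1976), §1–§2.
-/

noncomputable section

open Matrix Module
open scoped MatrixGroups

namespace Literature.Geometry.Kaehler

namespace ComplexTorus

/-! ### Generic group lemmas (file-local): the derived series of a subgroup, pushed into the ambient group -/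

section DerivedSeries

variable {G : Type*} [Group G] (H : Subgroup G)

/-- `D⁰(H) = H` inside `G`. [folklore] -/
private theorem hpd_map_subtype_derivedSeries_zero : (derivedSeries H 0).map H.subtype = H := by
  rw [derivedSeries_zero, ← MonoidHom.range_eq_map, Subgroup.range_subtype]

/-- `Dⁿ⁺¹(H) = (Dⁿ(H), Dⁿ(H))` inside `G`. [folklore] -/
private theorem hpd_map_subtype_derivedSeries_succ (n : ℕ) :
    (derivedSeries H (n + 1)).map H.subtype =
      ⁅(derivedSeries H n).map H.subtype, (derivedSeries H n).map H.subtype⁆ := by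
  rw [derivedSeries_succ, Subgroup.map_commutator]

/-- `D¹(H) = (H, H)` inside `G`. [folklore] -/
private theorem hpd_map_subtype_derivedSeries_one : (derivedSeries H 1).map H.subtype = ⁅H, H⁆ := by
  rw [hpd_map_subtype_derivedSeries_succ, hpd_map_subtype_derivedSeries_zero]

/-- `H` is solvable iff some `Dⁿ(H)` is trivial (inside `G`). [folklore] -/
private theorem hpd_isSolvable_iff_exists_map_subtype_derivedSeries_eq_bot :
    IsSolvable H ↔ ∃ n, (derivedSeries H n).map H.subtype = ⊥ := by
  rw [isSolvable_def]
  exact exists_congr fun n ↦ ((derivedSeries H n).map_eq_bot_iff_of_injective H.subtype_injective).symm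

variable {H} in
/-- The derived series is antitone: `Dᵐ(H) = 1 ⟹ Dⁿ(H) = 1` for `m ≤ n`. [folklore] -/
private theorem hpd_map_subtype_derivedSeries_eq_bot_of_le {m n : ℕ} (hmn : m ≤ n)
    (h : (derivedSeries H m).map H.subtype = ⊥) : (derivedSeries H n).map H.subtype = ⊥ := by
  rw [(derivedSeries H m).map_eq_bot_iff_of_injective H.subtype_injective] at h
  rw [(derivedSeries H n).map_eq_bot_iff_of_injective H.subtype_injective]
  exact le_bot_iff.1 ((derivedSeries_antitone (G := ↥H) hmn).trans h.le)

end DerivedSeries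

variable {ι₁ ι₂ : Type*} [Fintype ι₁] [Fintype ι₂] [DecidableEq ι₁] [DecidableEq ι₂]
  {E₁ E₂ : Type*} [NormedAddCommGroup E₁] [NormedSpace ℂ E₁] [NormedAddCommGroup E₂] [NormedSpace ℂ E₂]
  (Φ₁ : (ι₁ → ℝ) ≃L[ℝ] E₁) (Φ₂ : (ι₂ → ℝ) ≃L[ℝ] E₂)

/-! ## §1 `Dⁿ(Hg(X₁ × X₂)(ℂ)) ≤ Dⁿ(Hg(X₁)(ℂ)) × Dⁿ(Hg(X₂)(ℂ))` -/

section Inclusion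

omit Φ₁ Φ₂ in
/-- `(H₁ × H₂, K₁ × K₂) = (H₁, K₁) × (H₂, K₂)` for block-diagonal products in `SL(V₁ ⊕ V₂)(ℂ)`.
[cite: Imai1976HodgeGroups, §2 Proposition (p. 370: "`q([H, H]) = [q(H), q(H)]`")] -/
theorem commutator_blockDiagProd (H₁ K₁ : Subgroup (SpecialLinearGroup ι₁ ℂ)) (H₂ K₂ : Subgroup (SpecialLinearGroup ι₂ ℂ)) :
    ⁅blockDiagProd H₁ H₂, blockDiagProd K₁ K₂⁆ = blockDiagProd ⁅H₁, K₁⁆ ⁅H₂, K₂⁆ := by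
  rw [blockDiagProd, blockDiagProd, blockDiagProd, ← Subgroup.map_commutator, Subgroup.commutator_prod_prod]

/-- **`Dⁿ(Hg(X₁ × X₂)(ℂ)) ≤ Dⁿ(Hg(X₁)(ℂ)) × Dⁿ(Hg(X₂)(ℂ))`** (block-diagonally; `n = 0` is "`Hg(X₁ × X₂) ⊂
Hg(X₁) × Hg(X₂)`"). [cite: Imai1976HodgeGroups, §1 (p. 367) and §2 Proposition (p. 370)] [cite: MoonenZarhin1999LowDim, §3 (3.1)] -/
theorem map_derivedSeries_hodgeGroupC_prod_le_blockDiagProd (n : ℕ) :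
    (derivedSeries ↥(hodgeGroupC (prodPeriod Φ₁ Φ₂)) n).map (hodgeGroupC (prodPeriod Φ₁ Φ₂)).subtype ≤
      blockDiagProd ((derivedSeries ↥(hodgeGroupC Φ₁) n).map (hodgeGroupC Φ₁).subtype)
        ((derivedSeries ↥(hodgeGroupC Φ₂) n).map (hodgeGroupC Φ₂).subtype) := by
  induction n with
  | zero =>
    rw [hpd_map_subtype_derivedSeries_zero, hpd_map_subtype_derivedSeries_zero, hpd_map_subtype_derivedSeries_zero]
    exact hodgeGroupC_prod_le_blockDiagProd Φ₁ Φ₂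
  | succ n ih =>
    rw [hpd_map_subtype_derivedSeries_succ, hpd_map_subtype_derivedSeries_succ, hpd_map_subtype_derivedSeries_succ,
      ← commutator_blockDiagProd]
    exact Subgroup.commutator_mono ih ih

/-- The blocks of an element of `Dⁿ(Hg(X₁ × X₂)(ℂ))` lie in `Dⁿ(Hg(X₁)(ℂ))` and `Dⁿ(Hg(X₂)(ℂ))`.
[cite: Imai1976HodgeGroups, §2 Proposition (p. 370)] [cite: MoonenZarhin1999LowDim, §3 (3.1)] -/
theorem mem_map_derivedSeries_of_blockDiagC_mem (n : ℕ) {s : SpecialLinearGroup ι₁ ℂ} {t : SpecialLinearGroup ι₂ ℂ}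
    (h : blockDiagC ι₁ ι₂ (s, t) ∈
      (derivedSeries ↥(hodgeGroupC (prodPeriod Φ₁ Φ₂)) n).map (hodgeGroupC (prodPeriod Φ₁ Φ₂)).subtype) :
    s ∈ (derivedSeries ↥(hodgeGroupC Φ₁) n).map (hodgeGroupC Φ₁).subtype ∧
      t ∈ (derivedSeries ↥(hodgeGroupC Φ₂) n).map (hodgeGroupC Φ₂).subtype :=
  blockDiagC_mem_blockDiagProd_iff.1 (map_derivedSeries_hodgeGroupC_prod_le_blockDiagProd Φ₁ Φ₂ n h)

end Inclusion

/-! ## §2 The projections `Dⁿ(Hg(X₁ × X₂)(ℂ)) → Dⁿ(Hg(Xᵢ)(ℂ))` are onto -/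

section Surjective

/-- **Every `t ∈ Dⁿ(Hg(X₂)(ℂ))` is the second block of some `(s 0; 0 t) ∈ Dⁿ(Hg(X₁ × X₂)(ℂ))`, `s ∈ Dⁿ(Hg(X₁)(ℂ))`**
(`n = 0`: `pr₂` is onto, g37-#1; step: the commutator of two lifts is a lift of the commutator and lies in the next
term of the derived series of `Hg(X₁ × X₂)(ℂ)`). [cite: Imai1976HodgeGroups, §2 Proposition (p. 370: "`q([H, H]) = [q(H), q(H)]`")]
[cite: MoonenZarhin1999LowDim, §3 (3.1)] [cite: Gordon1997, §2.16 Proposition] -/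
theorem exists_blockDiagC_mem_map_derivedSeries_prod_right (n : ℕ) {t : SpecialLinearGroup ι₂ ℂ}
    (ht : t ∈ (derivedSeries ↥(hodgeGroupC Φ₂) n).map (hodgeGroupC Φ₂).subtype) :
    ∃ s ∈ (derivedSeries ↥(hodgeGroupC Φ₁) n).map (hodgeGroupC Φ₁).subtype, blockDiagC ι₁ ι₂ (s, t) ∈
      (derivedSeries ↥(hodgeGroupC (prodPeriod Φ₁ Φ₂)) n).map (hodgeGroupC (prodPeriod Φ₁ Φ₂)).subtype := by
  induction n generalizing t with
  | zero =>
    rw [hpd_map_subtype_derivedSeries_zero] at ht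
    rw [hpd_map_subtype_derivedSeries_zero, hpd_map_subtype_derivedSeries_zero]
    exact exists_blockDiagC_mem_hodgeGroupC_prod_right Φ₁ Φ₂ ht
  | succ n ih =>
    rw [hpd_map_subtype_derivedSeries_succ, Subgroup.commutator_def] at ht
    rw [hpd_map_subtype_derivedSeries_succ, hpd_map_subtype_derivedSeries_succ]
    refine Subgroup.closure_induction (p := fun t _ ↦
      ∃ s ∈ ⁅(derivedSeries ↥(hodgeGroupC Φ₁) n).map (hodgeGroupC Φ₁).subtype,
        (derivedSeries ↥(hodgeGroupC Φ₁) n).map (hodgeGroupC Φ₁).subtype⁆, blockDiagC ι₁ ι₂ (s, t) ∈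
          ⁅(derivedSeries ↥(hodgeGroupC (prodPeriod Φ₁ Φ₂)) n).map (hodgeGroupC (prodPeriod Φ₁ Φ₂)).subtype,
            (derivedSeries ↥(hodgeGroupC (prodPeriod Φ₁ Φ₂)) n).map (hodgeGroupC (prodPeriod Φ₁ Φ₂)).subtype⁆)
      ?_ ?_ ?_ ?_ ht
    · rintro _ ⟨a, ha, b, hb, rfl⟩
      obtain ⟨a', ha', haa⟩ := ih ha
      obtain ⟨b', hb', hbb⟩ := ih hb
      refine ⟨a' * b' * a'⁻¹ * b'⁻¹, Subgroup.commutator_mem_commutator ha' hb', ?_⟩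
      rw [commutatorElement_def, show (a' * b' * a'⁻¹ * b'⁻¹, a * b * a⁻¹ * b⁻¹) =
        (a', a) * (b', b) * (a', a)⁻¹ * (b', b)⁻¹ from rfl, map_mul, map_mul, map_mul, map_inv, map_inv]
      exact Subgroup.commutator_mem_commutator haa hbb
    · refine ⟨1, one_mem _, ?_⟩
      rw [show ((1 : SpecialLinearGroup ι₁ ℂ), (1 : SpecialLinearGroup ι₂ ℂ)) = 1 from rfl, map_one]
      exact one_mem _
    · rintro x y _ _ ⟨s, hs, hsx⟩ ⟨s', hs', hsy⟩
      refine ⟨s * s', mul_mem hs hs', ?_⟩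
      rw [show (s * s', x * y) = (s, x) * (s', y) from rfl, map_mul]
      exact mul_mem hsx hsy
    · rintro x _ ⟨s, hs, hsx⟩
      refine ⟨s⁻¹, inv_mem hs, ?_⟩
      rw [show (s⁻¹, x⁻¹) = (s, x)⁻¹ from rfl, map_inv]
      exact inv_mem hsx

/-- **Every `s ∈ Dⁿ(Hg(X₁)(ℂ))` is the first block of some `(s 0; 0 t) ∈ Dⁿ(Hg(X₁ × X₂)(ℂ))`, `t ∈ Dⁿ(Hg(X₂)(ℂ))`.**
[cite: Imai1976HodgeGroups, §2 Proposition (p. 370: "`q([H, H]) = [q(H), q(H)]`")] [cite: MoonenZarhin1999LowDim, §3 (3.1)]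
[cite: Gordon1997, §2.16 Proposition] -/
theorem exists_blockDiagC_mem_map_derivedSeries_prod_left (n : ℕ) {s : SpecialLinearGroup ι₁ ℂ}
    (hs : s ∈ (derivedSeries ↥(hodgeGroupC Φ₁) n).map (hodgeGroupC Φ₁).subtype) :
    ∃ t ∈ (derivedSeries ↥(hodgeGroupC Φ₂) n).map (hodgeGroupC Φ₂).subtype, blockDiagC ι₁ ι₂ (s, t) ∈
      (derivedSeries ↥(hodgeGroupC (prodPeriod Φ₁ Φ₂)) n).map (hodgeGroupC (prodPeriod Φ₁ Φ₂)).subtype := by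
  induction n generalizing s with
  | zero =>
    rw [hpd_map_subtype_derivedSeries_zero] at hs
    rw [hpd_map_subtype_derivedSeries_zero, hpd_map_subtype_derivedSeries_zero]
    exact exists_blockDiagC_mem_hodgeGroupC_prod_left Φ₁ Φ₂ hs
  | succ n ih =>
    rw [hpd_map_subtype_derivedSeries_succ, Subgroup.commutator_def] at hs
    rw [hpd_map_subtype_derivedSeries_succ, hpd_map_subtype_derivedSeries_succ]
    refine Subgroup.closure_induction (p := fun s _ ↦
      ∃ t ∈ ⁅(derivedSeries ↥(hodgeGroupC Φ₂) n).map (hodgeGroupC Φ₂).subtype,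
        (derivedSeries ↥(hodgeGroupC Φ₂) n).map (hodgeGroupC Φ₂).subtype⁆, blockDiagC ι₁ ι₂ (s, t) ∈
          ⁅(derivedSeries ↥(hodgeGroupC (prodPeriod Φ₁ Φ₂)) n).map (hodgeGroupC (prodPeriod Φ₁ Φ₂)).subtype,
            (derivedSeries ↥(hodgeGroupC (prodPeriod Φ₁ Φ₂)) n).map (hodgeGroupC (prodPeriod Φ₁ Φ₂)).subtype⁆)
      ?_ ?_ ?_ ?_ hs
    · rintro _ ⟨a, ha, b, hb, rfl⟩
      obtain ⟨a', ha', haa⟩ := ih ha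
      obtain ⟨b', hb', hbb⟩ := ih hb
      refine ⟨a' * b' * a'⁻¹ * b'⁻¹, Subgroup.commutator_mem_commutator ha' hb', ?_⟩
      rw [commutatorElement_def, show (a * b * a⁻¹ * b⁻¹, a' * b' * a'⁻¹ * b'⁻¹) =
        (a, a') * (b, b') * (a, a')⁻¹ * (b, b')⁻¹ from rfl, map_mul, map_mul, map_mul, map_inv, map_inv]
      exact Subgroup.commutator_mem_commutator haa hbb
    · refine ⟨1, one_mem _, ?_⟩
      rw [show ((1 : SpecialLinearGroup ι₁ ℂ), (1 : SpecialLinearGroup ι₂ ℂ)) = 1 from rfl, map_one]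
      exact one_mem _
    · rintro x y _ _ ⟨t, ht, htx⟩ ⟨t', ht', hty⟩
      refine ⟨t * t', mul_mem ht ht', ?_⟩
      rw [show (x * y, t * t') = (x, t) * (y, t') from rfl, map_mul]
      exact mul_mem htx hty
    · rintro x _ ⟨t, ht, htx⟩
      refine ⟨t⁻¹, inv_mem ht, ?_⟩
      rw [show (x⁻¹, t⁻¹) = (x, t)⁻¹ from rfl, map_inv]
      exact inv_mem htx

/-- **The first projection maps `Dⁿ(Hg(X₁ × X₂)(ℂ))` ONTO `Dⁿ(Hg(X₁)(ℂ))`**: `s ∈ Dⁿ(Hg(X₁)(ℂ))` iff `(s 0; 0 t) ∈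
Dⁿ(Hg(X₁ × X₂)(ℂ))` for some `t`. [cite: Imai1976HodgeGroups, §2 Proposition (p. 370)] [cite: MoonenZarhin1999LowDim, §3 (3.1)] -/
theorem mem_map_derivedSeries_iff_exists_blockDiagC_mem_left (n : ℕ) {s : SpecialLinearGroup ι₁ ℂ} :
    s ∈ (derivedSeries ↥(hodgeGroupC Φ₁) n).map (hodgeGroupC Φ₁).subtype ↔ ∃ t : SpecialLinearGroup ι₂ ℂ,
      blockDiagC ι₁ ι₂ (s, t) ∈
        (derivedSeries ↥(hodgeGroupC (prodPeriod Φ₁ Φ₂)) n).map (hodgeGroupC (prodPeriod Φ₁ Φ₂)).subtype := by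
  constructor
  · intro hs
    obtain ⟨t, -, h⟩ := exists_blockDiagC_mem_map_derivedSeries_prod_left Φ₁ Φ₂ n hs
    exact ⟨t, h⟩
  · rintro ⟨t, h⟩
    exact (mem_map_derivedSeries_of_blockDiagC_mem Φ₁ Φ₂ n h).1

/-- **The second projection maps `Dⁿ(Hg(X₁ × X₂)(ℂ))` ONTO `Dⁿ(Hg(X₂)(ℂ))`.** [cite: Imai1976HodgeGroups, §2 Proposition (p. 370)]
[cite: MoonenZarhin1999LowDim, §3 (3.1)] -/
theorem mem_map_derivedSeries_iff_exists_blockDiagC_mem_right (n : ℕ) {t : SpecialLinearGroup ι₂ ℂ} :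
    t ∈ (derivedSeries ↥(hodgeGroupC Φ₂) n).map (hodgeGroupC Φ₂).subtype ↔ ∃ s : SpecialLinearGroup ι₁ ℂ,
      blockDiagC ι₁ ι₂ (s, t) ∈
        (derivedSeries ↥(hodgeGroupC (prodPeriod Φ₁ Φ₂)) n).map (hodgeGroupC (prodPeriod Φ₁ Φ₂)).subtype := by
  constructor
  · intro ht
    obtain ⟨s, -, h⟩ := exists_blockDiagC_mem_map_derivedSeries_prod_right Φ₁ Φ₂ n ht
    exact ⟨s, h⟩
  · rintro ⟨s, h⟩
    exact (mem_map_derivedSeries_of_blockDiagC_mem Φ₁ Φ₂ n h).2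

/-- The `n = 1` case on elements: every `s ∈ (Hg(X₁)(ℂ), Hg(X₁)(ℂ))` is the first block of some
`(s 0; 0 t) ∈ (Hg(X₁ × X₂)(ℂ), Hg(X₁ × X₂)(ℂ))` with `t ∈ (Hg(X₂)(ℂ), Hg(X₂)(ℂ))`.
[cite: Imai1976HodgeGroups, §2 Proposition (p. 370: "`q([H, H]) = [q(H), q(H)]`")] -/
theorem exists_blockDiagC_mem_commutator_hodgeGroupC_prod_left {s : SpecialLinearGroup ι₁ ℂ}
    (hs : s ∈ ⁅hodgeGroupC Φ₁, hodgeGroupC Φ₁⁆) :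
    ∃ t ∈ ⁅hodgeGroupC Φ₂, hodgeGroupC Φ₂⁆,
      blockDiagC ι₁ ι₂ (s, t) ∈ ⁅hodgeGroupC (prodPeriod Φ₁ Φ₂), hodgeGroupC (prodPeriod Φ₁ Φ₂)⁆ := by
  have h := exists_blockDiagC_mem_map_derivedSeries_prod_left Φ₁ Φ₂ 1
    ((hpd_map_subtype_derivedSeries_one (hodgeGroupC Φ₁)).symm ▸ hs)
  rwa [hpd_map_subtype_derivedSeries_one, hpd_map_subtype_derivedSeries_one] at h

/-- The `n = 1` case on elements, second factor. [cite: Imai1976HodgeGroups, §2 Proposition (p. 370)] -/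
theorem exists_blockDiagC_mem_commutator_hodgeGroupC_prod_right {t : SpecialLinearGroup ι₂ ℂ}
    (ht : t ∈ ⁅hodgeGroupC Φ₂, hodgeGroupC Φ₂⁆) :
    ∃ s ∈ ⁅hodgeGroupC Φ₁, hodgeGroupC Φ₁⁆,
      blockDiagC ι₁ ι₂ (s, t) ∈ ⁅hodgeGroupC (prodPeriod Φ₁ Φ₂), hodgeGroupC (prodPeriod Φ₁ Φ₂)⁆ := by
  have h := exists_blockDiagC_mem_map_derivedSeries_prod_right Φ₁ Φ₂ 1
    ((hpd_map_subtype_derivedSeries_one (hodgeGroupC Φ₂)).symm ▸ ht)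
  rwa [hpd_map_subtype_derivedSeries_one, hpd_map_subtype_derivedSeries_one] at h

/-- `(Hg(X₁ × X₂)(ℂ), Hg(X₁ × X₂)(ℂ)) ≤ (Hg(X₁)(ℂ), Hg(X₁)(ℂ)) × (Hg(X₂)(ℂ), Hg(X₂)(ℂ))` (the `n = 1` inclusion).
[cite: Imai1976HodgeGroups, §2 Proposition (p. 370)] [cite: MoonenZarhin1999LowDim, §3 (3.1)] -/
theorem commutator_hodgeGroupC_prod_le_blockDiagProd :
    ⁅hodgeGroupC (prodPeriod Φ₁ Φ₂), hodgeGroupC (prodPeriod Φ₁ Φ₂)⁆ ≤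
      blockDiagProd ⁅hodgeGroupC Φ₁, hodgeGroupC Φ₁⁆ ⁅hodgeGroupC Φ₂, hodgeGroupC Φ₂⁆ := by
  rw [← commutator_blockDiagProd]
  exact Subgroup.commutator_mono (hodgeGroupC_prod_le_blockDiagProd Φ₁ Φ₂) (hodgeGroupC_prod_le_blockDiagProd Φ₁ Φ₂)

end Surjective

/-! ## §3 Perfectness, triviality of `Dⁿ`, solvability: product versus factors -/

section Transfer

/-- **`Hg(X₁ × X₂)(ℂ)` perfect ⟹ `Hg(X₁)(ℂ)` perfect** (the derived group projects onto the derived group).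
[cite: Imai1976HodgeGroups, §2 Proposition (p. 370)] [cite: Gordon1997, §2.5.2 Corollary] -/
theorem commutator_hodgeGroupC_eq_self_left_of_prod
    (h : ⁅hodgeGroupC (prodPeriod Φ₁ Φ₂), hodgeGroupC (prodPeriod Φ₁ Φ₂)⁆ = hodgeGroupC (prodPeriod Φ₁ Φ₂)) :
    ⁅hodgeGroupC Φ₁, hodgeGroupC Φ₁⁆ = hodgeGroupC Φ₁ := by
  refine le_antisymm (Subgroup.commutator_le_self _) fun s hs ↦ ?_
  obtain ⟨t, -, hst⟩ := exists_blockDiagC_mem_hodgeGroupC_prod_left Φ₁ Φ₂ hs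
  rw [← h] at hst
  exact (blockDiagC_mem_blockDiagProd_iff.1 (commutator_hodgeGroupC_prod_le_blockDiagProd Φ₁ Φ₂ hst)).1

/-- **`Hg(X₁ × X₂)(ℂ)` perfect ⟹ `Hg(X₂)(ℂ)` perfect.** [cite: Imai1976HodgeGroups, §2 Proposition (p. 370)] [cite: Gordon1997, §2.5.2 Corollary] -/
theorem commutator_hodgeGroupC_eq_self_right_of_prod
    (h : ⁅hodgeGroupC (prodPeriod Φ₁ Φ₂), hodgeGroupC (prodPeriod Φ₁ Φ₂)⁆ = hodgeGroupC (prodPeriod Φ₁ Φ₂)) :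
    ⁅hodgeGroupC Φ₂, hodgeGroupC Φ₂⁆ = hodgeGroupC Φ₂ := by
  refine le_antisymm (Subgroup.commutator_le_self _) fun t ht ↦ ?_
  obtain ⟨s, -, hst⟩ := exists_blockDiagC_mem_hodgeGroupC_prod_right Φ₁ Φ₂ ht
  rw [← h] at hst
  exact (blockDiagC_mem_blockDiagProd_iff.1 (commutator_hodgeGroupC_prod_le_blockDiagProd Φ₁ Φ₂ hst)).2

/-- **`Dⁿ(Hg(X₁ × X₂)(ℂ)) = 1 ⟺ Dⁿ(Hg(X₁)(ℂ)) = 1 ∧ Dⁿ(Hg(X₂)(ℂ)) = 1`** (⟹ by the surjective projections,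
⟸ by the inclusion). [cite: MoonenZarhin1999LowDim, §3 (3.1)] [cite: Imai1976HodgeGroups, §2 Proposition (p. 370)] -/
theorem map_derivedSeries_hodgeGroupC_prod_eq_bot_iff (n : ℕ) :
    (derivedSeries ↥(hodgeGroupC (prodPeriod Φ₁ Φ₂)) n).map (hodgeGroupC (prodPeriod Φ₁ Φ₂)).subtype = ⊥ ↔
      (derivedSeries ↥(hodgeGroupC Φ₁) n).map (hodgeGroupC Φ₁).subtype = ⊥ ∧
        (derivedSeries ↥(hodgeGroupC Φ₂) n).map (hodgeGroupC Φ₂).subtype = ⊥ := by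
  constructor
  · intro h
    refine ⟨(Subgroup.eq_bot_iff_forall _).2 fun s hs ↦ ?_, (Subgroup.eq_bot_iff_forall _).2 fun t ht ↦ ?_⟩
    · obtain ⟨t, -, hst⟩ := exists_blockDiagC_mem_map_derivedSeries_prod_left Φ₁ Φ₂ n hs
      rw [h, Subgroup.mem_bot, show (1 : SpecialLinearGroup (ι₁ ⊕ ι₂) ℂ) = blockDiagC ι₁ ι₂ (1, 1) from
        (map_one _).symm] at hst
      exact (Prod.mk.inj (blockDiagC_injective ι₁ ι₂ hst)).1
    · obtain ⟨s, -, hst⟩ := exists_blockDiagC_mem_map_derivedSeries_prod_right Φ₁ Φ₂ n ht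
      rw [h, Subgroup.mem_bot, show (1 : SpecialLinearGroup (ι₁ ⊕ ι₂) ℂ) = blockDiagC ι₁ ι₂ (1, 1) from
        (map_one _).symm] at hst
      exact (Prod.mk.inj (blockDiagC_injective ι₁ ι₂ hst)).2
  · rintro ⟨h₁, h₂⟩
    refine (Subgroup.eq_bot_iff_forall _).2 fun M hM ↦ ?_
    obtain ⟨s, hs, t, ht, rfl⟩ := mem_blockDiagProd_iff.1 (map_derivedSeries_hodgeGroupC_prod_le_blockDiagProd Φ₁ Φ₂ n hM)
    rw [h₁, Subgroup.mem_bot] at hs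
    rw [h₂, Subgroup.mem_bot] at ht
    subst hs ht
    exact map_one _

/-- **`(Hg(X₁ × X₂)(ℂ), Hg(X₁ × X₂)(ℂ)) = 1 ⟺ (Hg(X₁)(ℂ), Hg(X₁)(ℂ)) = 1 ∧ (Hg(X₂)(ℂ), Hg(X₂)(ℂ)) = 1`** — the
commutator-subgroup form of p22's `hodgeGroupC_prod_comm_iff` ("`X₁ × X₂` is of CM-type iff `X₁` and `X₂` are").
[cite: MoonenZarhin1999LowDim, §3 (3.1) and §1] [cite: Gordon1997, §2.12 Proposition] -/
theorem commutator_hodgeGroupC_prod_eq_bot_iff :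
    ⁅hodgeGroupC (prodPeriod Φ₁ Φ₂), hodgeGroupC (prodPeriod Φ₁ Φ₂)⁆ = ⊥ ↔
      ⁅hodgeGroupC Φ₁, hodgeGroupC Φ₁⁆ = ⊥ ∧ ⁅hodgeGroupC Φ₂, hodgeGroupC Φ₂⁆ = ⊥ := by
  have h := map_derivedSeries_hodgeGroupC_prod_eq_bot_iff Φ₁ Φ₂ 1
  rwa [hpd_map_subtype_derivedSeries_one, hpd_map_subtype_derivedSeries_one, hpd_map_subtype_derivedSeries_one] at h

/-- **`Hg(X₁ × X₂)(ℂ)` is solvable iff `Hg(X₁)(ℂ)` and `Hg(X₂)(ℂ)` are** (every pair of complex tori; for abelian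
varieties "solvable" is "of CM-type", p22's `IsAbelianVariety.isSolvable_hodgeGroupC_iff`).
[cite: MoonenZarhin1999LowDim, §3 (3.1) and §1] [cite: Gordon1997, §2.12 Proposition and §2.16 Proposition] -/
theorem isSolvable_hodgeGroupC_prod_iff :
    IsSolvable ↥(hodgeGroupC (prodPeriod Φ₁ Φ₂)) ↔ IsSolvable ↥(hodgeGroupC Φ₁) ∧ IsSolvable ↥(hodgeGroupC Φ₂) := by
  rw [hpd_isSolvable_iff_exists_map_subtype_derivedSeries_eq_bot,
    hpd_isSolvable_iff_exists_map_subtype_derivedSeries_eq_bot,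
    hpd_isSolvable_iff_exists_map_subtype_derivedSeries_eq_bot]
  constructor
  · rintro ⟨n, hn⟩
    rw [map_derivedSeries_hodgeGroupC_prod_eq_bot_iff] at hn
    exact ⟨⟨n, hn.1⟩, ⟨n, hn.2⟩⟩
  · rintro ⟨⟨n₁, h₁⟩, ⟨n₂, h₂⟩⟩
    exact ⟨max n₁ n₂, (map_derivedSeries_hodgeGroupC_prod_eq_bot_iff Φ₁ Φ₂ _).2
      ⟨hpd_map_subtype_derivedSeries_eq_bot_of_le (le_max_left _ _) h₁,
        hpd_map_subtype_derivedSeries_eq_bot_of_le (le_max_right _ _) h₂⟩⟩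

/-- `Hg(X₁ × X₂)(ℂ)` solvable ⟹ `Hg(X₁)(ℂ)` solvable. [cite: MoonenZarhin1999LowDim, §3 (3.1)] -/
theorem isSolvable_hodgeGroupC_left_of_prod (h : IsSolvable ↥(hodgeGroupC (prodPeriod Φ₁ Φ₂))) :
    IsSolvable ↥(hodgeGroupC Φ₁) :=
  ((isSolvable_hodgeGroupC_prod_iff Φ₁ Φ₂).1 h).1

/-- `Hg(X₁ × X₂)(ℂ)` solvable ⟹ `Hg(X₂)(ℂ)` solvable. [cite: MoonenZarhin1999LowDim, §3 (3.1)] -/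
theorem isSolvable_hodgeGroupC_right_of_prod (h : IsSolvable ↥(hodgeGroupC (prodPeriod Φ₁ Φ₂))) :
    IsSolvable ↥(hodgeGroupC Φ₂) :=
  ((isSolvable_hodgeGroupC_prod_iff Φ₁ Φ₂).1 h).2

/-- `Hg(X₁)(ℂ)`, `Hg(X₂)(ℂ)` solvable ⟹ `Hg(X₁ × X₂)(ℂ)` solvable. [cite: MoonenZarhin1999LowDim, §3 (3.1)] -/
theorem isSolvable_hodgeGroupC_prod (h₁ : IsSolvable ↥(hodgeGroupC Φ₁)) (h₂ : IsSolvable ↥(hodgeGroupC Φ₂)) :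
    IsSolvable ↥(hodgeGroupC (prodPeriod Φ₁ Φ₂)) :=
  (isSolvable_hodgeGroupC_prod_iff Φ₁ Φ₂).2 ⟨h₁, h₂⟩

variable {Φ₁ Φ₂} in
/-- **For polarised tori: `Hg(X₁ × X₂)` semisimple ⟹ `Hg(X₁)` and `Hg(X₂)` semisimple** (radical form, through p22's
"semisimple ⟺ perfect" `IsRiemannForm.radical_map_toGL_hodgeGroupC_eq_bot_iff_commutator_eq` for `X₁`, `X₂` and the
polarised product `X₁ × X₂`). [cite: Gordon1997, §2.5.2 Corollary] [cite: MoonenZarhin1999LowDim, §1 and §3 (3.1)] -/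
theorem IsRiemannForm.radical_map_toGL_hodgeGroupC_eq_bot_of_prod {η₁ : E₁ [⋀^Fin 2]→L[ℝ] ℝ}
    {η₂ : E₂ [⋀^Fin 2]→L[ℝ] ℝ} (hη₁ : IsRiemannForm Φ₁ η₁) (hη₂ : IsRiemannForm Φ₂ η₂)
    (h : Literature.NumberTheory.Automorphic.radical
      ((hodgeGroupC (prodPeriod Φ₁ Φ₂)).map Matrix.SpecialLinearGroup.toGL) = ⊥) :
    Literature.NumberTheory.Automorphic.radical ((hodgeGroupC Φ₁).map Matrix.SpecialLinearGroup.toGL) = ⊥ ∧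
      Literature.NumberTheory.Automorphic.radical ((hodgeGroupC Φ₂).map Matrix.SpecialLinearGroup.toGL) = ⊥ := by
  have hperf := (hη₁.prod hη₂).radical_map_toGL_hodgeGroupC_eq_bot_iff_commutator_eq.1 h
  exact ⟨hη₁.radical_map_toGL_hodgeGroupC_eq_bot_iff_commutator_eq.2
      (commutator_hodgeGroupC_eq_self_left_of_prod Φ₁ Φ₂ hperf),
    hη₂.radical_map_toGL_hodgeGroupC_eq_bot_iff_commutator_eq.2
      (commutator_hodgeGroupC_eq_self_right_of_prod Φ₁ Φ₂ hperf)⟩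

end Transfer

end ComplexTorus

end Literature.Geometry.Kaehler

end
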